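import Summits.QuantumFields.BalabanUV.Beta.CombChartContactFactor
import Summits.QuantumFields.BalabanUV.Beta.WardLocusSymSockets
import Summits.QuantumFields.BalabanUV.Beta.KernelWardSymEnd
import Summits.QuantumFields.BalabanUV.Beta.SymRootedAveragingMatrix

/-!
# `BalabanUV.Beta.CombChartWardSockets` — binder row D1, RULING R-D1-g35-1 (chart (III′)), brick P4c-W-i: **THE MULTIPLIER-COLUMN AND PARITY SOCKETS OF THE
# COMB-CHART RESOLVENT `G′_j = GcombSh Lc j`** for the slot-generic second-order Ward chain (`WardLocusRecursiveLettersSlot.exists_kernelLaws_of_letters_slot`) and the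
# parity form of the Ward END — the (III′) twin of `WardLocusSymSockets` §1 + `KernelWardSymEnd` §3: `colM G′_j = colM (KInvStep Lc j)` (hence both multiplier-column Ward
# laws), `G′_j`'s multiplier rows vanish off the coarse lattice, and `G′_j` is sgn-symmetric (`trK G′_j = sgnK G′_j`) — all from `GcombSh_inr_inr` (the comb dressing
# touches field legs only), chart (II)'s sockets and the sgn-algebra of `piK`

HONEST FRAMING (cell contract, verbatim): «discharging `BetaPertH` makes Bałaban's UV stability UNCONDITIONAL — a real constructive-QFT
result; it is NOT the continuum limit and NOT the Clay problem.»  HONEST DEPENDENCY: continuum YM on T⁴ ⇐ BetaPertH ∧ nine spine estimates (0/9 proved);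
BetaPertH ⇐ (D1) ∧ (D4) ∧ CAP+tail; G-an2-4 gates asym, D1 and NE2/3/4.
DERIVED cell leaf ([folklore] kernel bookkeeping BY NAME; β sub-cell, BINDER-OWNERS row D1 OWNER `b2b-balaban-beta-an2` gen 36).  No statement of Bałaban's papers,
no `[cite:]`, no `Prop` fact, no `def`.  WHAT: §1 `colM_GcombSh`, **`colM_GcombSh_ward`**, `colM_GcombSh_ward_resp`, **`GcombSh_inr_inr_off`**; §2 `sgnK_piK`, **`trK_coDressKAt`**
(generic spread sgn-symmetric `K`, in-block root: `trK (Π̂_ρᵀ K Π̂_ρ) = sgnK (Π̂_ρᵀ K Π̂_ρ)` — twin of `KernelWardSymEnd.trK_coDressKSymAt`), **`trK_GcombSh : trK G′_j = sgnK G′_j`**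
(so `KernelWardRelativeEnd.tadpole_eq_zero_of_parity` applies to `G′_j`: parity-odd localised remainders have zero tadpole against it).  Discharges NO binder of the row by itself;
NOT D1, NOT `BetaPertH`, NOT continuum, NOT Clay.
Provenance: β sub-cell, unit beta-an2 gen 36, 2026-08-22 (v1); over `CombChartContactFactor` (this gen), `WardLocusSymSockets`, `KernelWardMColumn`, `KernelWardSymEnd`,
`BubbleParity`, `SymRootedAveragingMatrix` (`sgnK_trK_piK`) BY NAME; no existing file touched.
-/

noncomputable section

open Finset
open scoped BigOperators
open Literature.MathematicalPhysics.QuantumFieldTheory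
open Literature.MathematicalPhysics.QuantumFieldTheory.Balaban1983to89
open Literature.MathematicalPhysics.QuantumFieldTheory.Balaban1983to89.Beta
open B6BondElimination (unitVec)
open ExpKernelCalculus (MKer comp)
open AffineAveraging (Site box toSite)
open AveragingContoursRooted (ctr ctrOff ctrOff_mem_box)
open OneStepResolventKernel (Fib)
open OneStepKernelFamily (KInvStep)
open SecondOrderResponse (colM)
open Summit.QuantumFields.BalabanUV.Beta.TameKernelCalculus
open Summit.QuantumFields.BalabanUV.Beta.AxialDressingRooted (one_le_of_neZero piK piK_inl_inr piK_inr_inl coDressKAt coDressKAt_eq spr_piK spr_trK_piK)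
open Summit.QuantumFields.BalabanUV.Beta.BorderedHessian (sgnK comp_sgnK trK_sgnK sgnK_eq_self)
open Summit.QuantumFields.BalabanUV.Beta.BubbleParity (comp_sgnK_left_of_eq_self)
open Summit.QuantumFields.BalabanUV.Beta.KernelWardMColumn (colM_KInvStep_ward colM_KInvStep_ward_resp)
open Summit.QuantumFields.BalabanUV.Beta.SymmetrisedStepJets (Gsym Gsym_apply)
open Summit.QuantumFields.BalabanUV.Beta.RelInvFactorSandwich (spr_Gsym)
open Summit.QuantumFields.BalabanUV.Beta.WardLocusSymSockets (colM_Gsym Gsym_inr_inr_off)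
open Summit.QuantumFields.BalabanUV.Beta.KernelWardSymEnd (trK_coDressKSymAt_KInvStep)
open Summit.QuantumFields.BalabanUV.Beta.SymRootedAveragingMatrix (sgnK_trK_piK)
open Summit.QuantumFields.BalabanUV.Beta.CombChartStepJets (GcombSh GcombSh_apply)
open Summit.QuantumFields.BalabanUV.Beta.CombChartContactFactor (GcombSh_inr_inr spr_GcombSh)

namespace Summit.QuantumFields.BalabanUV.Beta.CombChartWardSockets

variable {d : ℕ} {Lc : ℕ} [NeZero Lc]

/-! ## §1 Multiplier columns -/

/-- [folklore] **THE COMB RE-DRESSING DOES NOT TOUCH THE MULTIPLIER COLUMNS**: `colM G′_j = colM G_j = colM (KInvStep Lc j)`. -/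
theorem colM_GcombSh (j : ℕ) (μ : Fin (d + 1)) (y : Fin (d + 1) → ℤ) (ρ : Fin (d + 1)) (w : Fin (d + 1) → ℤ) :
    colM (GcombSh (d := d) Lc j) Lc μ y ρ w = colM (KInvStep (d := d) Lc j) Lc μ y ρ w := by
  rw [← colM_Gsym]
  simp only [colM, GcombSh_inr_inr]

/-- [folklore] **(hMw) FOR `G′_j`: THE MULTIPLIER-COLUMN WARD LAW, SOURCE SLOT, EVERY LEVEL.** -/
theorem colM_GcombSh_ward (j : ℕ) (y : Fin (d + 1) → ℤ) (ρ : Fin (d + 1)) (w : Fin (d + 1) → ℤ) :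
    ∑ μ, (colM (GcombSh (d := d) Lc j) Lc μ (y - unitVec μ) ρ w - colM (GcombSh (d := d) Lc j) Lc μ y ρ w) = 0 := by
  simp only [colM_GcombSh]
  exact colM_KInvStep_ward j y ρ w

/-- [folklore] (hMw, response slot) for `G′_j`. -/
theorem colM_GcombSh_ward_resp (j : ℕ) (μ : Fin (d + 1)) (y w : Fin (d + 1) → ℤ) :
    ∑ ρ, (colM (GcombSh (d := d) Lc j) Lc μ y ρ (w - unitVec ρ) - colM (GcombSh (d := d) Lc j) Lc μ y ρ w) = 0 := by
  simp only [colM_GcombSh]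
  exact colM_KInvStep_ward_resp j μ y w

/-- [folklore] **(hoff) FOR `G′_j`: THE MULTIPLIER ROWS VANISH OFF THE COARSE LATTICE.** -/
theorem GcombSh_inr_inr_off (j : ℕ) (x : Fin (d + 1) → ℤ) (hx : Literature.Probability.LatticeModels.Torus.proj Lc x ≠ 0) (z : Fin (d + 1) → ℤ)
    (ρ μ : Fin (d + 1)) : GcombSh (d := d) Lc j x z (Sum.inr ρ) (Sum.inr μ) = 0 := by
  rw [GcombSh_inr_inr]
  exact Gsym_inr_inr_off j x hx z ρ μ

/-! ## §2 Parity: `G′_j` is sgn-symmetric -/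

/-- [folklore] `piK` has vanishing mixed blocks, so `sgnK` fixes it. -/
theorem sgnK_piK (ρ : Fin (d + 1) → ℤ) (N : ℕ) : sgnK (piK (d := d) ρ N) = piK ρ N :=
  sgnK_eq_self (fun x y κ l => piK_inl_inr ρ N x y κ l) (fun x y κ l => piK_inr_inl ρ N x y κ l)

/-- [folklore] **Rooted comb co-dressing preserves sgn-symmetry** (twin of `KernelWardSymEnd.trK_coDressKSymAt`): for a spread sgn-symmetric `K` and an in-block root,
`trK (Π̂_ρᵀ K Π̂_ρ) = sgnK (Π̂_ρᵀ K Π̂_ρ)`. -/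
theorem trK_coDressKAt {N : ℕ} (hN : 1 ≤ N) {r : Fin (d + 1) → ℕ} (hr : r ∈ box (d + 1) N) {K : MKer (d + 1) (Fib d)}
    (hK : Spr K) (hKt : trK K = sgnK K) :
    trK (coDressKAt (toSite r) N K) = sgnK (coDressKAt (toSite r) N K) := by
  rw [coDressKAt_eq, trK_comp, trK_comp, trK_trK, hKt, comp_sgnK_left_of_eq_self (sgnK_piK _ _)]
  have h : comp (trK (piK (d := d) (toSite r) N)) (sgnK (comp K (piK (toSite r) N))) =
      comp (sgnK (trK (piK (d := d) (toSite r) N))) (sgnK (comp K (piK (toSite r) N))) := by rw [sgnK_trK_piK]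
  rw [h, comp_sgnK, comp_assoc_tame (spr_trK_piK hN hr).tame hK.tame (spr_piK hN hr).tame]

/-- [folklore] **THE COMB-CHART RESOLVENTS ARE sgn-SYMMETRIC**: `trK (GcombSh Lc j) = sgnK (GcombSh Lc j)` (every `j`; `trK_coDressKAt` at the sgn-symmetric `G_j`,
`KernelWardSymEnd.trK_coDressKSymAt_KInvStep`). -/
theorem trK_GcombSh (j : ℕ) : trK (GcombSh (d := d) Lc j) = sgnK (GcombSh (d := d) Lc j) := by
  have hGt : trK (Gsym (d := d) Lc j) = sgnK (Gsym (d := d) Lc j) := by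
    rw [Gsym_apply]
    exact trK_coDressKSymAt_KInvStep (d := d) (ctrOff_mem_box (one_le_of_neZero Lc)) j
  rw [GcombSh_apply]
  exact trK_coDressKAt (one_le_of_neZero Lc) (ctrOff_mem_box (one_le_of_neZero Lc)) (spr_Gsym j) hGt

end Summit.QuantumFields.BalabanUV.Beta.CombChartWardSockets

end
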